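import Summits.QuantumAdvantage.AdviceFreeQNC0.TensorLPNorm
import Summits.QuantumAdvantage.AdviceFreeQNC0.DiversityRungs
import HarnessLib

/-!
# Cell qa-qnc0 (rung F-Q1, density axis, crux of record `TensorMultOneAt`): the SYMMETRIC PRODUCT
# UPPER BOUND — `TensorMultAt m 1 β → β·2^m ≤ w_sym(m)`, hence MULT₁ at one block size needs `m ≥ 14`

Planner qa-qnc0-p1 gen 13 (`HOME/qa-qnc0-p1/ROUND-12.md` §0(4), TARGET §25.3/§25.7: "at `t = 1` the
threshold is `β > 1/4`; the exact single-block optimum is `w(m,1)/2^m = .2444 (12), .2666 (14), …`;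
`t = 1` forces `m* ≥ 14`").  The upper half of that statement needs only ONE block: `TensorMultAt m 1 β`
at `k = 1` says `β·2^m ≤ #FAIL(win)` for every single even eliminator triple `win` of degree `≤ 1`, and
the SYMMETRIC affine triples (`T_r = a_r ⊕ b_r·parity`, `T₂ = T₀ ⊕ T₁`) fail on exactly one class
`|u| mod 6 ∈ {0,2,4}` and one class in `{1,3,5}` of our choice, i.e. on `N_{jₑ} + N_{jₒ}` inputs
(`N_j = #{u : |u| ≡ j (6)}`, `DiversityRungs.N6`).  Proved here:

* `TensorUB.sumCodeWin_symPat` — the symmetric triple is an element of the one-block sum code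
  `SumCodeWin (m·1) 1 1`; `TensorUB.failCount_symPat` — its failure count by classes mod 6;
* **`tensorMultAt_one_le`**: `TensorMultAt m 1 β → β·2^m ≤ N6 m jₑ + N6 m jₒ` for every
  `jₑ ∈ {0,2,4}`, `jₒ ∈ {1,3,5}` (so `β ≤ w_sym(m)/2^m`, `w_sym = min + min`, the value prover-2's
  `diversityPays_sym` shows is also a LOWER bound for symmetric last players);
* **`fourteen_le_of_tensorMultAt`**: `1/4 < β → TensorMultAt m 1 β → 14 ≤ m` (the thirteen checks
  `w_sym(m) ≤ 2^m/4`, `m ≤ 13`: `0,0,0,0,1,2,8,16,45,90,220,440,1001,2002`), and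
  **`tensorMultOneAt_iff_fourteen`**: `TensorMultOneAt ↔ ∃ m ≥ 14, ∃ β > 1/4, TensorMultAt m 1 β`;
* numeric caps `tensorMultAt_eight_le : TensorMultAt 8 1 β → β ≤ 45/256` and
  `tensorMultAt_fourteen_le : TensorMultAt 14 1 β → β ≤ 4368/16384` (vs the LP floors `1/7`, resp. the
  payoff threshold `1/4 < 4368/16384 = .2666`).

The cell's statements (not in print).  WHAT THIS IS NOT: no lower bound (those are
`TensorLPCertificates.lean`); `w_sym(m) = w(m,1)` (optimality of symmetric triples among ALL degree-1
triples, planner's `kit13/w1_exact.py`) is not claimed here; nothing on α; separation NOT moved.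
-/

noncomputable section

namespace Summit.QuantumAdvantage.AdviceFreeQNC0

open Finset
open Literature.Computability.MetaComplexity Literature.Computability.MetaComplexity.Smolensky
open DiversityRungs TensorLP

namespace TensorUB

variable {n : ℕ}

/-! ### Symmetric affine functions have degree `≤ 1` -/

/-- Parity bit of `u`. -/
def par (u : Fin n → Bool) : Bool := decide (wt u % 2 = 1)

/-- The parity function has `𝔽₂`-degree `≤ 1` (`Σ_i x_i`). -/
theorem hasDeg_par : HasDeg (par (n := n)) 1 := by
  unfold HasDeg
  have h : (fun x : Fin n → Bool => if par x = true then (1 : ZMod 2) else 0) =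
      ∑ i : Fin n, mono (ZMod 2) ({i} : Finset (Fin n)) := by
    funext x
    rw [Finset.sum_apply]
    have h1 : (if par x = true then (1 : ZMod 2) else 0) = ι (par x) := by unfold ι; rfl
    rw [h1, par, show wt x = (univ.filter fun j : Fin n => x j = true).card from rfl, ι_decide_card]
    refine sum_congr rfl fun i _ => ?_
    rw [mono_apply]
    unfold ι
    by_cases hx : x i = true
    · rw [if_pos hx, if_pos (fun j hj => by rwa [Finset.mem_singleton.1 hj])]
    · rw [if_neg hx, if_neg (fun h => hx (h i (Finset.mem_singleton_self i)))]
  rw [h]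
  exact Submodule.sum_mem _ fun i _ => mono_mem_lowDeg (by simp)

/-- Constants have degree `≤ 1`. -/
theorem hasDeg_const (b : Bool) : HasDeg (fun _ : Fin n → Bool => b) 1 := by
  unfold HasDeg
  cases b
  · have : (fun _ : Fin n → Bool => if false = true then (1 : ZMod 2) else 0) = 0 := by funext; simp
    rw [this]; exact Submodule.zero_mem _
  · have : (fun _ : Fin n → Bool => if true = true then (1 : ZMod 2) else 0) = 1 := by funext; simp
    rw [this]; exact one_mem_lowDeg 1

/-- The symmetric affine function `u ↦ a ⊕ (b ∧ parity u)`. -/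
def affSym (a b : Bool) (u : Fin n → Bool) : Bool := xor a (b && par u)

/-- Symmetric affine functions have degree `≤ 1`. -/
theorem hasDeg_affSym (a b : Bool) : HasDeg (affSym (n := n) a b) 1 := by
  unfold affSym
  cases b
  · simpa using hasDeg_const (n := n) a
  · simpa using hasDeg_xor (hasDeg_const (n := n) a) hasDeg_par

/-! ### The symmetric even triple and its pattern -/

/-- The symmetric even triple with bits `a₀ b₀ a₁ b₁`: `T₀ = a₀ ⊕ b₀·par`, `T₁ = a₁ ⊕ b₁·par`,
`T₂ = T₀ ⊕ T₁` (indices `≥ 2` all read as `2`). -/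
def symT (a₀ b₀ a₁ b₁ : Bool) (r : ℕ) (u : Fin n → Bool) : Bool :=
  if r = 0 then affSym a₀ b₀ u else if r = 1 then affSym a₁ b₁ u
  else xor (affSym a₀ b₀ u) (affSym a₁ b₁ u)

/-- The win pattern of the symmetric triple: `u ↦ T_{|u| mod 3}(u)`. -/
def symPat (a₀ b₀ a₁ b₁ : Bool) (u : Fin n → Bool) : Bool := symT a₀ b₀ a₁ b₁ (wt u % 3) u

/-- The value table of the symmetric triple by `|u| mod 6` (residue `j mod 3`, parity `j mod 2`). -/
def symVal (a₀ b₀ a₁ b₁ : Bool) (j : ℕ) : Bool :=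
  let p : Bool := decide (j % 2 = 1)
  if j % 3 = 0 then xor a₀ (b₀ && p) else if j % 3 = 1 then xor a₁ (b₁ && p)
  else xor (xor a₀ (b₀ && p)) (xor a₁ (b₁ && p))

/-- The pattern is the value table read at `|u| mod 6`. -/
theorem symPat_eq_symVal (a₀ b₀ a₁ b₁ : Bool) (u : Fin n → Bool) :
    symPat a₀ b₀ a₁ b₁ u = symVal a₀ b₀ a₁ b₁ (wt u % 6) := by
  unfold symPat symT symVal affSym par
  have h3 : wt u % 3 = wt u % 6 % 3 := by omega
  have h2 : wt u % 2 = wt u % 6 % 2 := by omega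
  rw [h3, h2]

/-- With one block, every coordinate is in block `0`. -/
theorem blockIdx_one (m : ℕ) (i : Fin (m * 1)) : blockIdx (m * 1) 1 i = 0 := by
  unfold blockIdx
  rw [Nat.mul_one]
  exact Nat.div_eq_of_lt i.isLt

/-- With one block, merging block `0` replaces everything. -/
theorem mergeBlock_one (m : ℕ) (v w : Fin (m * 1) → Bool) : mergeBlock (m * 1) 1 0 v w = w := by
  funext i; simp [mergeBlock, blockIdx_one]

/-- With one block, the block weight is the Hamming weight. -/
theorem blockWt_one (m : ℕ) (u : Fin (m * 1) → Bool) : blockWt (m * 1) 1 0 u = wt u := by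
  unfold blockWt wt
  congr 1; ext i; simp [blockIdx_one]

/-- **The symmetric triple is an element of the one-block degree-`1` sum code.** -/
theorem sumCodeWin_symPat (m : ℕ) (a₀ b₀ a₁ b₁ : Bool) :
    SumCodeWin (m * 1) 1 1 (symPat (n := m * 1) a₀ b₀ a₁ b₁) := by
  refine ⟨fun _ => symPat a₀ b₀ a₁ b₁, fun j hj => ?_, fun u => ?_⟩
  · have hj0 : j = 0 := by omega
    subst hj0
    refine ⟨symT a₀ b₀ a₁ b₁, fun r v => ?_, fun u => ?_, fun u => ?_⟩
    · show HasDeg (fun w => symT a₀ b₀ a₁ b₁ r (mergeBlock (m * 1) 1 0 v w)) 1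
      simp only [mergeBlock_one]
      unfold symT
      by_cases h0 : r = 0
      · simp only [h0, if_true]; exact hasDeg_affSym a₀ b₀
      · by_cases h1 : r = 1
        · simp only [h1, if_true]; exact hasDeg_affSym a₁ b₁
        · simp only [h0, h1, if_false]; exact hasDeg_xor (hasDeg_affSym a₀ b₀) (hasDeg_affSym a₁ b₁)
    · unfold symT
      simp only [if_true, show (1 : ℕ) ≠ 0 from one_ne_zero, if_false, show (2 : ℕ) ≠ 0 from two_ne_zero,
        show (2 : ℕ) ≠ 1 from by norm_num]
      cases affSym a₀ b₀ u <;> cases affSym a₁ b₁ u <;> rfl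
    · show symPat a₀ b₀ a₁ b₁ u = symT a₀ b₀ a₁ b₁ (blockWt (m * 1) 1 0 u % 3) u
      rw [blockWt_one]; rfl
  · rw [range_one, filter_singleton]
    cases h : symPat a₀ b₀ a₁ b₁ u <;> simp [h]

/-- **Failure count of the symmetric triple**, by the classes `|u| mod 6`. -/
theorem failCount_symPat (a₀ b₀ a₁ b₁ : Bool) :
    failCount (symPat (n := n) a₀ b₀ a₁ b₁) =
      ∑ j ∈ (range 6).filter (fun j => symVal a₀ b₀ a₁ b₁ j = false), N6 n j := by
  unfold failCount N6
  rw [card_eq_sum_card_fiberwise (f := fun u : Fin n → Bool => wt u % 6)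
    (t := (range 6).filter fun j => symVal a₀ b₀ a₁ b₁ j = false) (fun u hu => ?_)]
  · refine sum_congr rfl fun j hj => ?_
    congr 1; ext u
    simp only [mem_filter, mem_univ, true_and, symPat_eq_symVal]
    constructor
    · rintro ⟨_, h⟩; exact h
    · intro h; refine ⟨?_, h⟩; rw [h]; exact (mem_filter.1 hj).2
  · simp only [coe_filter, mem_univ, true_and, Set.mem_setOf_eq, mem_range] at hu ⊢
    exact ⟨Nat.mod_lt _ (by norm_num), by rw [← symPat_eq_symVal]; exact hu⟩

end TensorUB

open TensorUB

/-! ### The upper bound on the ratio, and `m ≥ 14` -/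

/-- **Symmetric product upper bound**: if `TensorMultAt m 1 β`, then `β·2^m ≤ N_{jₑ} + N_{jₒ}` for every
even class `jₑ ∈ {0,2,4}` and odd class `jₒ ∈ {1,3,5}` (take `k = 1` and the symmetric triple failing
exactly on those two classes). -/
theorem tensorMultAt_one_le {m : ℕ} {β : ℝ} (hT : TensorMultAt m 1 β) {je jo : ℕ}
    (hje : je = 0 ∨ je = 2 ∨ je = 4) (hjo : jo = 1 ∨ jo = 3 ∨ jo = 5) :
    β * (2 : ℝ) ^ m ≤ ((N6 m je + N6 m jo : ℕ) : ℝ) := by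
  -- bits realising "fail exactly on `je` among even classes and on `jo` among odd classes"
  obtain ⟨a₀, a₁, hev⟩ : ∃ a₀ a₁ : Bool, ∀ j, (j = 0 ∨ j = 2 ∨ j = 4) →
      ((if j % 3 = 0 then a₀ else if j % 3 = 1 then a₁ else xor a₀ a₁) = false ↔ j = je) := by
    rcases hje with rfl | rfl | rfl
    · exact ⟨false, true, fun j hj => by rcases hj with rfl | rfl | rfl <;> decide⟩
    · exact ⟨true, true, fun j hj => by rcases hj with rfl | rfl | rfl <;> decide⟩
    · exact ⟨true, false, fun j hj => by rcases hj with rfl | rfl | rfl <;> decide⟩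
  obtain ⟨c₀, c₁, hod⟩ : ∃ c₀ c₁ : Bool, ∀ j, (j = 1 ∨ j = 3 ∨ j = 5) →
      ((if j % 3 = 0 then c₀ else if j % 3 = 1 then c₁ else xor c₀ c₁) = false ↔ j = jo) := by
    rcases hjo with rfl | rfl | rfl
    · exact ⟨true, false, fun j hj => by rcases hj with rfl | rfl | rfl <;> decide⟩
    · exact ⟨false, true, fun j hj => by rcases hj with rfl | rfl | rfl <;> decide⟩
    · exact ⟨true, true, fun j hj => by rcases hj with rfl | rfl | rfl <;> decide⟩
  set b₀ := xor a₀ c₀ with hb₀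
  set b₁ := xor a₁ c₁ with hb₁
  -- the value table fails exactly at `je` and `jo`
  have hval : ∀ j < 6, (symVal a₀ b₀ a₁ b₁ j = false ↔ j = je ∨ j = jo) := by
    intro j hj
    have hcases : (j = 0 ∨ j = 2 ∨ j = 4) ∨ (j = 1 ∨ j = 3 ∨ j = 5) := by omega
    rcases hcases with hj' | hj'
    · have hp : decide (j % 2 = 1) = false := by rcases hj' with rfl | rfl | rfl <;> decide
      have hne : j ≠ jo := by rcases hj' with rfl | rfl | rfl <;> rcases hjo with rfl | rfl | rfl <;> omega
      unfold symVal
      simp only [hp, Bool.and_false, Bool.xor_false]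
      rw [hev j hj']
      exact ⟨Or.inl, fun h => h.elim id fun h => absurd h hne⟩
    · have hp : decide (j % 2 = 1) = true := by rcases hj' with rfl | rfl | rfl <;> decide
      have hne : j ≠ je := by rcases hj' with rfl | rfl | rfl <;> rcases hje with rfl | rfl | rfl <;> omega
      have e₀ : xor a₀ (b₀ && true) = c₀ := by rw [Bool.and_true, hb₀]; cases a₀ <;> cases c₀ <;> rfl
      have e₁ : xor a₁ (b₁ && true) = c₁ := by rw [Bool.and_true, hb₁]; cases a₁ <;> cases c₁ <;> rfl
      unfold symVal
      simp only [hp, e₀, e₁]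
      rw [hod j hj']
      exact ⟨Or.inr, fun h => h.elim (fun h => absurd h hne) id⟩
  -- failure count of this symmetric triple on `{0,1}^{m·1}`
  have hfilter : (range 6).filter (fun j => symVal a₀ b₀ a₁ b₁ j = false) = {je, jo} := by
    ext j
    simp only [mem_filter, mem_range, mem_insert, mem_singleton]
    constructor
    · rintro ⟨hj, h⟩; exact (hval j hj).1 h
    · intro h
      have hj : j < 6 := by rcases h with rfl | rfl <;> omega
      exact ⟨hj, (hval j hj).2 h⟩
  have hne : je ≠ jo := by rcases hje with rfl | rfl | rfl <;> rcases hjo with rfl | rfl | rfl <;> omega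
  have hfail : failCount (symPat (n := m * 1) a₀ b₀ a₁ b₁) = N6 m je + N6 m jo := by
    rw [failCount_symPat, hfilter, sum_pair hne, Nat.mul_one]
  have h := hT 1 Nat.one_pos (symPat a₀ b₀ a₁ b₁) (sumCodeWin_symPat m a₀ b₀ a₁ b₁)
  rw [pow_one, hfail] at h
  exact h

/-- `TensorMultAt 8 1 β → β ≤ 45/256` (`N₀ + N₁ = 29 + 16 = 45 = w(8,1)`; the LP floor is `1/7 = .1428`,
the symmetric cap `.1758`). -/
theorem tensorMultAt_eight_le {β : ℝ} (hT : TensorMultAt 8 1 β) : β ≤ 45 / 256 := by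
  have h := tensorMultAt_one_le hT (je := 0) (jo := 1) (Or.inl rfl) (Or.inl rfl)
  obtain ⟨h0, h1, -, -, -, -⟩ := N6_eight
  rw [h0, h1] at h
  norm_num at h
  linarith

/-- `TensorMultAt 14 1 β → β ≤ 4368/16384` (`N₄ + N₃ = 2002 + 2366`; `= .2666 > 1/4`: block size 14 can pay). -/
theorem tensorMultAt_fourteen_le {β : ℝ} (hT : TensorMultAt 14 1 β) : β ≤ 4368 / 16384 := by
  have h := tensorMultAt_one_le hT (je := 4) (jo := 3) (Or.inr (Or.inr rfl)) (Or.inr (Or.inl rfl))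
  obtain ⟨-, -, -, h3, h4, -⟩ := N6_fourteen
  rw [h3, h4] at h
  norm_num at h
  linarith

/-- The class counts needed below: for `m ≤ 13` some even class plus some odd class has at most
`2^m/4` vectors (`w_sym(m) = 0,0,0,0,1,2,8,16,45,90,220,440,1001,2002`). -/
theorem exists_light_classes :
    ∀ m ≤ 13, ∃ je jo : ℕ, (je = 0 ∨ je = 2 ∨ je = 4) ∧ (jo = 1 ∨ jo = 3 ∨ jo = 5) ∧
      4 * (N6 m je + N6 m jo) ≤ 2 ^ m := by
  intro m hm
  interval_cases m
  · exact ⟨2, 1, by norm_num, by norm_num, by rw [N6_eq_sum_choose, N6_eq_sum_choose]; decide⟩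
  · exact ⟨2, 3, by norm_num, by norm_num, by rw [N6_eq_sum_choose, N6_eq_sum_choose]; decide⟩
  · exact ⟨4, 3, by norm_num, by norm_num, by rw [N6_eq_sum_choose, N6_eq_sum_choose]; decide⟩
  · exact ⟨4, 5, by norm_num, by norm_num, by rw [N6_eq_sum_choose, N6_eq_sum_choose]; decide⟩
  · exact ⟨0, 5, by norm_num, by norm_num, by rw [N6_eq_sum_choose, N6_eq_sum_choose]; decide⟩
  · exact ⟨0, 5, by norm_num, by norm_num, by rw [N6_eq_sum_choose, N6_eq_sum_choose]; decide⟩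
  · exact ⟨0, 1, by norm_num, by norm_num, by rw [N6_eq_sum_choose, N6_eq_sum_choose]; decide⟩
  · exact ⟨0, 1, by norm_num, by norm_num, by rw [N6_eq_sum_choose, N6_eq_sum_choose]; decide⟩
  · exact ⟨0, 1, by norm_num, by norm_num, by rw [N6_eq_sum_choose, N6_eq_sum_choose]; decide⟩
  · exact ⟨2, 1, by norm_num, by norm_num, by rw [N6_eq_sum_choose, N6_eq_sum_choose]; decide⟩
  · exact ⟨2, 1, by norm_num, by norm_num, by rw [N6_eq_sum_choose, N6_eq_sum_choose]; decide⟩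
  · exact ⟨2, 3, by norm_num, by norm_num, by rw [N6_eq_sum_choose, N6_eq_sum_choose]; decide⟩
  · exact ⟨2, 3, by norm_num, by norm_num, by rw [N6_eq_sum_choose, N6_eq_sum_choose]; decide⟩
  · exact ⟨4, 3, by norm_num, by norm_num, by rw [N6_eq_sum_choose, N6_eq_sum_choose]; decide⟩

/-- **MULT₁ at one block size needs `m ≥ 14`**: `1/4 < β → TensorMultAt m 1 β → 14 ≤ m`
(planner TARGET §25.7 "`t = 1` forces `m* ≥ 14`", upper half, kernel). -/
theorem fourteen_le_of_tensorMultAt {m : ℕ} {β : ℝ} (hβ : 1 / 4 < β) (hT : TensorMultAt m 1 β) :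
    14 ≤ m := by
  by_contra hm
  obtain ⟨je, jo, hje, hjo, hw⟩ := exists_light_classes m (by omega)
  have h := tensorMultAt_one_le hT hje hjo
  have hw' : (4 : ℝ) * ((N6 m je + N6 m jo : ℕ) : ℝ) ≤ (2 : ℝ) ^ m := by exact_mod_cast hw
  have hpos : (0 : ℝ) < (2 : ℝ) ^ m := pow_pos two_pos m
  nlinarith

/-- **`TensorMultOneAt` lives at block sizes `≥ 14`**: the crux of record is equivalent to its
restriction to `m ≥ 14`. -/
theorem tensorMultOneAt_iff_fourteen :
    TensorMultOneAt ↔ ∃ (m : ℕ) (β : ℝ), 14 ≤ m ∧ 1 / 4 < β ∧ TensorMultAt m 1 β := by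
  constructor
  · rintro ⟨m, β, hβ, hT⟩
    exact ⟨m, β, fourteen_le_of_tensorMultAt hβ hT, hβ, hT⟩
  · rintro ⟨m, β, -, hβ, hT⟩
    exact ⟨m, β, hβ, hT⟩

end Summit.QuantumAdvantage.AdviceFreeQNC0
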